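import Literature.Computability.AlgebraicComplexity.BurgisserBooleanPartsHolds
import Literature.Computability.AlgebraicComplexity.BurgisserFiniteFields
import Literature.Computability.Complexity.BitGraphPPoly
import Literature.Computability.Complexity.CountingProofs
import Literature.Computability.Complexity.StockmeyerEstimator
import HarnessLib

/-!
# `#P ⊆ FP/poly` and `PP ⊆ P/poly` from `VP_k = VNP_k` under GRH (Bürgisser 2000, Cor. 1.2(1), `#P/poly = FP/poly`)

Topic `Literature/Computability/AlgebraicComplexity`; proof-only companion of
`BurgisserBooleanParts.lean` (Boolean parts, (A2), (A3)), `BurgisserFiniteFields.lean` ((B2):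
`#P ⊆ BP(VNP_k)`, proved) and `ValiantBooleanBridgeBurgisser*.lean` (the `P/NP/PH` collapse).
Bürgisser, *Cook's versus Valiant's hypothesis*, TCS 235 (2000), Cor. 1.2(1), p. 74: "We assume
(GRH). If Valiant's hypothesis were false over a field of characteristic zero, then we had
`NC³/poly = P/poly = NP/poly = PH/poly` **and `#P/poly = FP/poly`**." Printed proof (p. 79):
"Assume we had `VP_k = VNP_k`. For `char k = 0` we then obtain from Theorem 1.1 under (GRH) that
`#P/poly ⊆ BP(VNP_k) = BP(VP_k) ⊆ FNC³/poly ⊆ FP/poly ⊆ #P/poly`, thus we have equality everywhere."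
The tree had drawn from this chain only the LANGUAGE consequences (`NP ⊆ P/poly`, the advice
collapses); this file proves its COUNTING form for the tree's `#P`
(`Literature.Computability.Complexity.SharpP`: `f x = #{y ∈ {0,1}^{p |x|} | ⟨x, y⟩ ∈ R}`, `R ∈ P`)
and the consequence for Gill's `PP`:

* `sharpP_isBooleanPart_VNP` — **`#P ⊆ BP(VNP_k)`** in the form of Def. 2.1 (`IsBooleanPart`, bit
  size `p(n) + 1`): the tree's (B2) `sharpP_booleanPart_VNP_holds` (§5 (A2), pp. 84–85, proved in
  `BurgisserFiniteFields.lean` by arithmetising the verifier's `B₂`-programs) plus the bound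
  `f(x) ≤ 2^{p |x|}`.
* `sharpP_bitCircuits_of_VP_eq_VNP` — **`#P ⊆ FP/poly`** under GRH and `VP_k = VNP_k`,
  `char k = 0` (Cor. 1.2(1): `#P/poly = FP/poly`, uniform part): with `VP_k = VNP_k` the family is
  p-computable (`isVPFamily_of_VP_eq_VNP`, "`BP(VNP_k) = BP(VP_k)`"), and (A3) = Thm. 1.1(1),
  `BP(VP_k) ⊆ FP/poly` (`booleanPart_VP_cktSize_holds`, discharged in the tree from Thm. 4.5 and
  the effective prime ideal theorem under GRH), gives polynomial-size `B₂`-circuits for the bits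
  of `f`, packaged as `BitCircuits f` (`bitCircuits_of_cktSize`, the padding constructor announced
  in the docstring of `BitCircuits`, `BitGraphPPoly.lean`).
* `PSharpP_subset_PPoly_of_VP_eq_VNP`, `PP_subset_PPoly_of_VP_eq_VNP`,
  `VP_ne_VNP_of_ERH_of_not_PP_subset_PPoly` — hence `P^{#P} ⊆ P/poly` (`P/poly` is closed under
  polynomial-time Turing reductions, `BitGraphPPoly.lean`) and, with `PP ⊆ P^{#P}`
  (`PP_subset_PSharpP_holds`; Arora–Barak 2009, §17.2.1), **`PP ⊆ P/poly`**; contrapositively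
  GRH and `PP ⊄ P/poly` give `VP_k ≠ VNP_k` in characteristic zero — the Literature side of the
  strong-hypothesis bridge `GRH ∧ PP ⊄ P/poly ⟹ VP_ℂ ≠ VNP_ℂ`
  (`Summits/ValiantsHypothesis/StrongHypotheses.lean`).

No definitions, no named facts: theorems only (D-0026).

## References

* P. Bürgisser, *Cook's versus Valiant's hypothesis*, Theoret. Comput. Sci. 235 (2000) 71–88:
  Thm. 1.1(1) (p. 73), Cor. 1.2(1) (p. 74) and its proof (p. 79), Def. 2.1 (p. 75), §5 (A2)
  (pp. 84–85), (A3) (pp. 85–86). [Burgisser2000TCS]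
* P. Bürgisser, *Completeness and Reduction in Algebraic Complexity Theory*, Springer 2000,
  Thm. 4.5 and Cor. 4.6(1) (book version). [Burgisser2000]
* S. Arora, B. Barak, *Computational Complexity: A Modern Approach*, CUP 2009, Def. 6.5, Rem. 6.4,
  §17.2.1 (`PP ⊆ P^{#P}`). [AroraBarak2009]
-/

noncomputable section

open MvPolynomial Literature.Computability.Complexity Literature.Computability.Complexity.Classes
  _root_.Computability

namespace Literature.Computability.AlgebraicComplexity

universe u

/-! ### `#P ⊆ BP(VNP_k)` in the form of Def. 2.1 -/

/-- **`#P ⊆ BP(VNP_k)`** (Bürgisser 2000 TCS, §5 (A2), pp. 84–85, the uniform part of the inclusion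
`#P/poly ⊆ BP(VNP_k)` of Thm. 1.1(1)), in the form of Def. 2.1 (p. 75): for every `f ∈ #P` there is
a p-definable family `(F_n)`, `F_n ∈ k[X_1, …, X_n]`, of which the length-`n` restrictions
`x ↦ f(x)`, `x ∈ {0,1}ⁿ`, form a Boolean part of bit size `t(n) = p(n) + 1`, `p` the certificate
bound of `f` (`f(x) ≤ 2^{p |x|}`, `Stockmeyer.countWitnesses_le_two_pow`). The family is the tree's
(B2) `sharpP_booleanPart_VNP_holds` (`BurgisserFiniteFields.lean`: the Boolean sum of the gate
arithmetisation of the verifier's `B₂`-program at certificate length `p(n)`; the printed proof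
arithmetises the clauses of Cook's 3-CNF instead). In positive characteristic the identity reads
`f(x) mod p` (the cast). [cite: Burgisser2000TCS, §5 (A2) pp. 84–85 and Def. 2.1 p. 75] -/
theorem sharpP_isBooleanPart_VNP (k : Type u) [Field k] {f : List Bool → ℕ} (hf : f ∈ SharpP) :
    ∃ (F : ∀ n, MvPolynomial (Fin n) k) (t : ℕ → ℕ),
      IsVNPFamily F ∧ IsBooleanPart k F (fun _ x => f (List.ofFn x)) t := by
  obtain ⟨F, hVNP, hF⟩ := sharpP_booleanPart_VNP_holds k f hf
  obtain ⟨R, -, p, hfR⟩ := hf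
  refine ⟨F, fun n => p.eval n + 1, hVNP, ?_, fun n x => ?_, fun n x => hF n x⟩
  · exact IsPBounded.add_holds ((isPBounded_iff_exists_polynomial_holds _).2 ⟨p, fun n => le_rfl⟩)
      (IsPBounded.const 1)
  · -- `f x ≤ 2^{p |x|} < 2^{p |x| + 1}`
    show f (List.ofFn x) < 2 ^ (p.eval n + 1)
    rw [hfR, List.length_ofFn]
    exact (Stockmeyer.countWitnesses_le_two_pow R _ _).trans_lt
      (Nat.pow_lt_pow_right (by norm_num) (by omega))

/-! ### `#P ⊆ FP/poly`, `P^{#P} ⊆ P/poly` and `PP ⊆ P/poly` from `VP_k = VNP_k` under GRH -/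

/-- **Padding constructor for `BitCircuits`**: circuits for the `t(m)` low bits of `f` at every
input length `m`, with `f < 2^{t(m)}` there and `f x < 2^{K |x|}` for a polynomial `K`, give
`BitCircuits f` with exactly `K(m)` outputs — the missing high bits are the constant `0` (one
extra gate). This is the re-indexing constructor announced in the docstring of `BitCircuits`
(`BitGraphPPoly.lean`; Arora–Barak 2009, Rem. 6.4: unused outputs / constant wires are free up to
`O(1)` gates). [cite: AroraBarak2009, Rem. 6.4] -/
theorem bitCircuits_of_cktSize {f : List Bool → ℕ} (K s : Polynomial ℕ) (t : ℕ → ℕ)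
    (hlt : ∀ x : List Bool, f x < 2 ^ K.eval x.length)
    (ht : ∀ (m : ℕ) (x : Fin m → Bool), f (List.ofFn x) < 2 ^ t m)
    (hck : ∀ m : ℕ, CktSize B2 (fun (x : Fin m → Bool) (i : Fin (t m)) => (f (List.ofFn x)).testBit i)
      (s.eval m)) :
    Nonempty (BitCircuits f) := by
  refine ⟨{ K := K, s := s + 1, lt := hlt, ckt := fun m => ?_ }⟩
  have h := ((hck m).pair (cktSize_const (Fin m) false)).outMap
    fun i : Fin (K.eval m) => if hi : i.val < t m then Sum.inl ⟨i.val, hi⟩ else Sum.inr ()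
  refine (h.congr fun x i => ?_).of_le (le_of_eq (by simp))
  by_cases hi : i.val < t m
  · simp [hi]
  · simp only [hi, dif_neg, not_false_eq_true, Sum.elim_inr]
    exact (Nat.testBit_eq_false_of_lt ((ht m x).trans_le
      (Nat.pow_le_pow_right (by norm_num) (not_lt.1 hi)))).symm

/-- **`#P ⊆ FP/poly` from `VP_k = VNP_k` under GRH, `char k = 0`** (Bürgisser 2000 TCS,
Cor. 1.2(1), p. 74: "`#P/poly = FP/poly`", uniform part; proof p. 79:
"`#P/poly ⊆ BP(VNP_k) = BP(VP_k) ⊆ FNC³/poly ⊆ FP/poly`"): every `#P` function has polynomial-size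
`B₂`-circuits for its bits. Proof: `sharpP_isBooleanPart_VNP` (`#P ⊆ BP(VNP_k)`), `VP_k = VNP_k`
(`isVPFamily_of_VP_eq_VNP`), and (A3) = Thm. 1.1(1), `BP(VP_k) ⊆ FP/poly` under GRH in
characteristic zero (`booleanPart_VP_cktSize_holds`, discharged in the tree; book Thm. 4.5).
[cite: Burgisser2000TCS, Cor. 1.2(1) p. 74 and its proof p. 79] [cite: Burgisser2000, Thm. 4.5 and Cor. 4.6(1)] -/
theorem sharpP_bitCircuits_of_VP_eq_VNP (k : Type u) [Field k] [CharZero k]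
    (hGRH : Literature.NumberTheory.LFunctions.ExtendedRiemannHypothesis) (h : VP k = VNP k)
    {f : List Bool → ℕ} (hf : f ∈ SharpP) : Nonempty (BitCircuits f) := by
  obtain ⟨F, t, hVNP, hBP⟩ := sharpP_isBooleanPart_VNP k hf
  obtain ⟨q, hq⟩ := booleanPart_VP_cktSize_holds k hGRH F (fun _ x => f (List.ofFn x)) t
    (isVPFamily_of_VP_eq_VNP h hVNP) hBP
  obtain ⟨R, -, p, hfR⟩ := hf
  refine bitCircuits_of_cktSize (p + 1) q t (fun x => ?_) (fun m x => hBP.lt m x) hq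
  rw [hfR, Polynomial.eval_add, Polynomial.eval_one]
  exact (Stockmeyer.countWitnesses_le_two_pow R _ _).trans_lt
    (Nat.pow_lt_pow_right (by norm_num) (by omega))

/-- Hence **`P^{#P} ⊆ P/poly` from `VP_k = VNP_k` under GRH, `char k = 0`**: the bit graph of every
`#P` function is in `P/poly`, which is closed under polynomial-time Turing reductions
(`BitCircuits.PRel_ofFun_subset_PPoly_of_bitCircuits`). [cite: Burgisser2000TCS, Cor. 1.2(1) p. 74] -/
theorem PSharpP_subset_PPoly_of_VP_eq_VNP (k : Type u) [Field k] [CharZero k]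
    (hGRH : Literature.NumberTheory.LFunctions.ExtendedRiemannHypothesis) (h : VP k = VNP k) :
    PSharpP ⊆ PPoly := by
  intro L hL
  obtain ⟨f, hf, hLf⟩ := Set.mem_iUnion₂.1 hL
  obtain ⟨B⟩ := sharpP_bitCircuits_of_VP_eq_VNP k hGRH h hf
  exact B.PRel_ofFun_subset_PPoly_of_bitCircuits hLf

/-- **`PP ⊆ P/poly` from `VP_k = VNP_k` under GRH, `char k = 0`** (the Boolean consequence of
Bürgisser 2000 TCS, Cor. 1.2(1), `#P/poly = FP/poly`: a `PP` language is the threshold of a `#P`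
count, `PP ⊆ P^{#P}`, Arora–Barak 2009 §17.2.1, tree `PP_subset_PSharpP_holds`; and
`P^{#P} ⊆ P/poly`, `PSharpP_subset_PPoly_of_VP_eq_VNP`).
[cite: Burgisser2000TCS, Cor. 1.2(1) p. 74] [cite: AroraBarak2009, §17.2.1] -/
theorem PP_subset_PPoly_of_VP_eq_VNP (k : Type u) [Field k] [CharZero k]
    (hGRH : Literature.NumberTheory.LFunctions.ExtendedRiemannHypothesis) (h : VP k = VNP k) :
    PP ⊆ PPoly :=
  fun _L hL => PSharpP_subset_PPoly_of_VP_eq_VNP k hGRH h (PP_subset_PSharpP_holds hL)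

/-- **GRH ∧ `PP ⊄ P/poly` ⟹ `VP_k ≠ VNP_k`** for every field `k` of characteristic zero
(contrapositive of `PP_subset_PPoly_of_VP_eq_VNP`; Bürgisser 2000 TCS, Cor. 1.2(1): Valiant's
hypothesis fails in characteristic zero only if, under GRH, `#P/poly = FP/poly`).
[cite: Burgisser2000TCS, Cor. 1.2(1) p. 74] -/
theorem VP_ne_VNP_of_ERH_of_not_PP_subset_PPoly (k : Type u) [Field k] [CharZero k]
    (hGRH : Literature.NumberTheory.LFunctions.ExtendedRiemannHypothesis) (hPP : ¬ (PP ⊆ PPoly)) :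
    VP k ≠ VNP k :=
  fun h => hPP (PP_subset_PPoly_of_VP_eq_VNP k hGRH h)

end Literature.Computability.AlgebraicComplexity

end
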